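import Mathlib
import Literature.MathematicalPhysics.QuantumFieldTheory.Balaban1983to89.B6Commutator244TowerTorus

/-!
# `Balaban1983to89.B6TorusTransplant` — T. Bałaban, *Propagators and renormalization transformations for lattice gauge theories. II*,
Commun. Math. Phys. **96** (1984) 223–250 [Balaban1984PropagatorsII]: **the cube `□̃` of the one-scale torus IDENTIFIED WITH A SMALLER TORUS of the
tower family** (Sect. C p. 238: *"We take the cube □̃³ and identify it with a torus, denoted by T_□, imposing periodicity conditions"*) —
the transplant maps between the fine/unit tori of a volume `P = (d, L, m, K)` and of the small volume `P′ = (d, L, m′, K)`, the pull-back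
`J` of functions, the LOCALITY of `Δ′_a` under the transplant, and the CUT ALGEBRA `χ·Δ′_a·G′(□̃) = χ`, `G′(□̃)·Δ′_a·χ = χ` of the local
inverse `G′(□̃) := 1_V·J·G′_{P′}·Jᵀ·1_V` (the Green's function `Δ′_a⁻¹` of the small torus, pulled back to the window and cut to a core `V`)

statement-level skeleton of published theorems with citation tags; proofs where landed; nothing here is a claim about the Yang–Mills mass gap

Phase-2 PROOF SEAT p01 (gen 8) of the cell `lit-balaban` (HOME `run/shared/lean/pub/lit-balaban/`), free-target protocol G.5-34(d), own lane;
file 4 of the programme «the MODIFIED prescription of (2.70) `C_□ = ((Q′G′(□̃)²Q′*)↾□)⁻¹` with `G′(□̃)` on the torus `T_□̃` and the p. 238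
change-of-domain sentence, genuine»: this file supplies the located inputs `hχGw`, `hGwχ` (cut algebra) of the b2b line-3 chain
`B6Prop23DomainInput.hdom_of_line3` / `B6DomainMajorant.cutHyp_left/right` for the GENUINE operators, and the dictionary the majorant sibling
(`…B6TransplantMajorants`) and the (2.70) file use.  Sources read as page images: `run/shared/lean/pub/pub-balaban/b2b-balaban-ref1/pages/
1984-cmp96-propagators-rt-II/1984-cmp96-propagators-rt-II-p013-x2.png` (p. 235), `…-p016-x2.png` (p. 238), `…-p017-x2.png` (p. 239);
journal page = PDF page + 222.

THE PRINTED TEXT.  p. 235 [PDF 13]: *"We change this prescription a little bit; we take a second cube □̃ containing □ in the middle and of the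
size 4M and we take an inverse of the operator (Q′G′(□̃)²Q′*)↾□ instead of (Q′G′²Q′*)↾□."*  p. 229 [PDF 7]: *"G′(□) is an inverse of Δ′_a
with some boundary conditions on the boundary of □, e.g. with Neumann boundary conditions as in [3]."*  p. 238–239 [PDF 16–17]: *"We take
the cube □̃³ and identify it with a torus, denoted by T_□, imposing periodicity conditions. On this torus we define operators R, Δ_a as in
(2.17), (2.19) … Both operators are defined on the torus T_□."*  THE READING (declared): the boundary conditions of `G′(□̃)` are taken
PERIODIC — `□̃` is identified with the torus `T_□̃ = Site P′ 0` of the family (the print's own device for `G_□`), of unit side `2L^{m′}` (the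
family's sizes; the print's "4M" becomes `2L^{m′} ≥ 4M`), so that `G′(□̃) = Δ′_a⁻¹` on `T_□̃` IS the genuine one-scale operator of the small
volume, for which Prop. 2.2/2.3 and (2.68) are landed theorems of this lineage.

WHAT THIS FILE PROVES (kernel-checked, 0 sorry, axioms standard).  `P′ = smallVol P m′` (same `d, L, K`), window corner `c : Site P K`:
* §1 the transplant maps `iotaK`/`iota0` (unit/fine torus of `P` → those of `P′`, by the window chart `woff` of `…B6TorusWindowChart`) and the
  inverse parametrisation `kap0 : Site P′ 0 → Site P 0` of the fine window `W₀ = {woff < N′₀}`: `iota0 ∘ kap0 = id`, `kap0 ∘ iota0 = id` on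
  `W₀`, charts preserved (`woff_iotaK`, `woff_iota0`), blocks preserved (`blk_iota0`), unit shifts preserved inside the window
  (`iota0_shift`, `iota0_unshift`), blocks of `P` inside the window ↔ blocks of `P′` (`sum_block_transplant`).
* §2 the pull-back matrix `Jmat x z = [x = kap0 z]`: `(J g)(x) = g(iota0 x)` on `W₀` and `0` off it, `(Jᵀf)(z) = f(kap0 z)`, `JᵀJ = 1`,
  `JJᵀ = diag 1_{W₀}`.
* §3 **LOCALITY OF `Δ′_a` UNDER THE TRANSPLANT**: for a fine site `x` of a DEEP block (`1 ≤ woff(y)`, `woff(y) + 2 ≤ N′`) `(Δ′_a(Jw))(x) =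
  (Δ′_a^{P′}w)(iota0 x)` (`deltaPrime_J_apply`) — the operators *"defined on the torus T_□"* agree with those of the big torus away from the
  seam; as matrix identities `diag s·Δ′_a·J = diag s·J·Δ′_a^{P′}` for `s` supported on deep blocks (`diag_mul_deltaPrime_mul_J`) and, by
  transposition (both `Δ′_a` symmetric), `Jᵀ·Δ′_a·diag s = Δ′_a^{P′}·Jᵀ·diag s` (`Jt_mul_deltaPrime_mul_diag`).
* §4 **THE LOCAL INVERSE AND ITS CUT ALGEBRA**: `GwMat V = diag 1_V·J·G′_{P′}·Jᵀ·diag 1_V` (`V` a set of deep unit blocks of the window) and,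
  for a cut-off `χ` whose support together with its `Δ′_a`-range lies in `V`-blocks: **`diag χ·Δ′_a·G′(□̃) = diag χ`**, **`G′(□̃)·Δ′_a·diag χ
  = diag χ`** (`diag_chi_mul_D_mul_Gw`, `Gw_mul_D_mul_diag_chi`) and the `Module.End` forms `mulOp χ * Dop * Gw = mulOp χ`, `Gw * Dop * mulOp χ
  = mulOp χ` (`cutHyp_left_Gw`, `cutHyp_right_Gw`) — exactly the hypotheses `hχGw`, `hGwχ` of `B6Prop23DomainInput.hdom_of_line3`.

HONEST SCOPE ∕ NOT CLAIMED.  Periodic boundary conditions for `G′(□̃)` (declared reading above; the print suggests Neumann "e.g."); the cube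
sizes are the family's `2L^{m′}`; `G′(□̃)` enters the line-3 chain CUT to the core `V` (`1_V` on both sides) — on `V` it is the periodic
Green's function of `□̃`; the (2.70) operator `(Q′G′(□̃)²Q′*)↾□` itself is assembled in the sibling.  One scale, scalar model.  Value =
the transplant dictionary and the cut algebra for the genuine operators, NOT summit progress.
-/

namespace Literature.MathematicalPhysics.QuantumFieldTheory.Balaban1983to89.B6TorusTransplant

open Finset Matrix
open B1RG242Torus (tower Qk Qks lvl lvl_of_le sitesPerDir_zero_eq)
open B5Ineq137Torus (blk blk_val fine fine_val)
open B6QGGQInvTowerTorus (deltaPrimeK wQ deltaPrimeK_transpose G_mul_deltaPrimeK deltaPrimeK_mul_G G_transpose)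
open B6Eq239Commutator (blockAvgOp deltaPrimeA)
open LatticeFieldCalculus (laplace)
open B6Expansion282 (mulOp mulOp_apply)
open B6TorusWindowChart
open B10StarCount (shift_unshift unshift_shift)
open B6Commutator244TowerTorus (Dop Gop Dop_apply Dop_apply_eq Gop_apply_eq)

noncomputable section

variable (P : Params)

/-! ## §1  The small volume and the transplant maps -/

/-- **the small volume `P′ = (d, L, m′, K)`**: the torus `T_□̃ = Site P′ 0` with which the cube `□̃` (unit side `2L^{m′}`) is identified — same
dimension, same `L`, same number `K` of averaging steps (same mesh `η = L^{−K}`), smaller volume exponent `m′`.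
[cite: Balaban1984PropagatorsII, p.238 («identify it with a torus, denoted by T_□»)] -/
def smallVol (m' : ℕ) : Params := ⟨P.d, P.L, m', P.K, P.hd, P.hL⟩

/-- the sites per direction of the small tori: `2L^{m′+K−j}`. [cite: Balaban1984PropagatorsII, p.238; bookkeeping] -/
theorem sitesPerDir_smallVol (m' j : ℕ) : (smallVol P m').sitesPerDir j = 2 * P.L ^ (m' + P.K - j) := rfl

/-- the mesh of the small volume is that of the big one: `ε′ = L^{−K} = ε`. [cite: Balaban1984PropagatorsII, p.238; bookkeeping] -/
theorem eps_smallVol (m' : ℕ) : (smallVol P m').eps = P.eps := rfl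

/-- `N′ ≤ N` when `m′ ≤ m` (the cube fits in the big torus without self-overlap). [cite: Balaban1984PropagatorsII, p.235; bookkeeping] -/
theorem sitesPerDir_smallVol_le {m' : ℕ} (hm : m' ≤ P.m) (j : ℕ) : (smallVol P m').sitesPerDir j ≤ P.sitesPerDir j := by
  rw [sitesPerDir_smallVol]
  unfold Params.sitesPerDir
  exact Nat.mul_le_mul_left _ (Nat.pow_le_pow_right P.L_pos (by omega))

/-- `N′₀ = L^K·N′_K` for the small volume. [cite: Balaban1984PropagatorsII, (2.1) p.224; bookkeeping] -/
theorem sitesPerDir_smallVol_zero (m' : ℕ) : (smallVol P m').sitesPerDir 0 = P.L ^ P.K * (smallVol P m').sitesPerDir P.K := by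
  have hK : P.K ≤ (smallVol P m').m + (smallVol P m').K := Nat.le_add_left _ _
  have := sitesPerDir_zero_eq (smallVol P m') P.K
  rwa [lvl_of_le (smallVol P m') hK] at this

/-- the corner `0` of a torus of the family (the window corner of `T_□̃` itself). [cite: Balaban1984PropagatorsII, p.238; bookkeeping] -/
def origin (P : Params) (j : ℕ) : Site P j := fun _ => 0

/-- **the unit transplant** `ι_K : T₁^{(K)} → T′₁^{(K)}`, `y ↦ woff(y) mod N′` (meaningful on the window `woff(y) < N′`).
[cite: Balaban1984PropagatorsII, p.238 («identify it with a torus»)] -/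
def iotaK (c : Site P P.K) (m' : ℕ) (y : Site P P.K) : Site (smallVol P m') P.K :=
  fun μ => ((woff P P.K c y μ : ℕ) : ZMod ((smallVol P m').sitesPerDir P.K))

/-- **the fine transplant** `ι₀ : T_η → T′_η`, `x ↦ woff(x) mod N′₀` (fine chart with the block-aligned corner `fine P K c`).
[cite: Balaban1984PropagatorsII, p.238 («identify it with a torus»)] -/
def iota0 (c : Site P P.K) (m' : ℕ) (x : Site P 0) : Site (smallVol P m') 0 :=
  fun μ => ((woff P 0 (fine P P.K c) x μ : ℕ) : ZMod ((smallVol P m').sitesPerDir 0))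

/-- **the inverse parametrisation of the fine window** `κ₀ : T′_η → T_η`, `z ↦ c_f + z.val` — the fine site of the big torus with chart
coordinate `z`. [cite: Balaban1984PropagatorsII, p.238 («identify it with a torus»)] -/
def kap0 (c : Site P P.K) (m' : ℕ) (z : Site (smallVol P m') 0) : Site P 0 :=
  fun μ => fine P P.K c μ + (((z μ).val : ℕ) : ZMod (P.sitesPerDir 0))

/-- the fine window `W₀ = {x : woff(x)_μ < N′₀ ∀μ}` (the fine sites of the cube identified with `T_□̃`). [cite: Balaban1984PropagatorsII, p.238; bookkeeping] -/
def InW0 (c : Site P P.K) (m' : ℕ) (x : Site P 0) : Prop := ∀ μ, woff P 0 (fine P P.K c) x μ < (smallVol P m').sitesPerDir 0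

/-- the unit window `W = {y : woff(y)_μ < N′ ∀μ}` (the unit blocks of the cube `□̃`). [cite: Balaban1984PropagatorsII, p.238; bookkeeping] -/
def InW (c : Site P P.K) (m' : ℕ) (y : Site P P.K) : Prop := ∀ μ, woff P P.K c y μ < (smallVol P m').sitesPerDir P.K

/-- **deep blocks** of the window: unit chart coordinates in `[1, N′ − 2]` — their fine sites and the fine neighbours of those stay in the
window, away from its seam (where the locality of `Δ′_a` under the transplant holds). [cite: Balaban1984PropagatorsII, p.238; bookkeeping] -/
def DeepBlk (c : Site P P.K) (m' : ℕ) (y : Site P P.K) : Prop :=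
  ∀ μ, 1 ≤ woff P P.K c y μ ∧ woff P P.K c y μ + 2 ≤ (smallVol P m').sitesPerDir P.K

/-- membership in the unit window is decidable (finitely many comparisons). [cite: Balaban1984PropagatorsII, p.238; bookkeeping] -/
instance instDecidablePredInW (c : Site P P.K) (m' : ℕ) : DecidablePred (InW P c m') :=
  fun y => by unfold InW; infer_instance

/-- membership in the fine window is decidable. [cite: Balaban1984PropagatorsII, p.238; bookkeeping] -/
instance instDecidablePredInW0 (c : Site P P.K) (m' : ℕ) : DecidablePred (InW0 P c m') :=
  fun x => by unfold InW0; infer_instance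

/-- being a deep block is decidable. [cite: Balaban1984PropagatorsII, p.238; bookkeeping] -/
instance instDecidablePredDeepBlk (c : Site P P.K) (m' : ℕ) : DecidablePred (DeepBlk P c m') :=
  fun y => by unfold DeepBlk; infer_instance

variable {P}

section Maps

variable {c : Site P P.K} {m' : ℕ}

/-- a fine site is in the fine window iff its block is in the unit window. [cite: Balaban1984PropagatorsII, (2.1) p.224; bookkeeping] -/
theorem inW0_iff_inW (x : Site P 0) : InW0 P c m' x ↔ InW P c m' (blk P P.K x) := by
  have hn : 0 < P.L ^ P.K := pow_pos P.L_pos _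
  unfold InW0 InW
  rw [sitesPerDir_smallVol_zero]
  constructor
  · intro h μ
    have h1 := (woff_fine_mem c x μ).1
    have h2 := h μ
    by_contra hlt
    have hge : (smallVol P m').sitesPerDir P.K ≤ woff P P.K c (blk P P.K x) μ := not_lt.mp hlt
    have : P.L ^ P.K * (smallVol P m').sitesPerDir P.K ≤ P.L ^ P.K * woff P P.K c (blk P P.K x) μ := Nat.mul_le_mul_left _ hge
    omega
  · intro h μ
    have h2 := (woff_fine_mem c x μ).2
    have h1 := h μ
    calc woff P 0 (fine P P.K c) x μ < P.L ^ P.K * woff P P.K c (blk P P.K x) μ + P.L ^ P.K := by omega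
      _ = P.L ^ P.K * (woff P P.K c (blk P P.K x) μ + 1) := by ring
      _ ≤ P.L ^ P.K * (smallVol P m').sitesPerDir P.K := Nat.mul_le_mul_left _ (by omega)

/-- deep blocks are in the window. [cite: Balaban1984PropagatorsII, p.238; bookkeeping] -/
theorem inW_of_deepBlk {y : Site P P.K} (h : DeepBlk P c m' y) : InW P c m' y := fun μ => by have := (h μ).2; omega

/-- the fine sites of a deep block are away from the fine seam: `1 ≤ woff(x)` and `woff(x) + 2 ≤ N′₀`. [cite: Balaban1984PropagatorsII, p.238; bookkeeping] -/
theorem woff_bounds_of_deepBlk {x : Site P 0} (h : DeepBlk P c m' (blk P P.K x)) (μ : Fin P.d) :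
    1 ≤ woff P 0 (fine P P.K c) x μ ∧ woff P 0 (fine P P.K c) x μ + 2 ≤ (smallVol P m').sitesPerDir 0 := by
  have hn : 1 ≤ P.L ^ P.K := Nat.one_le_iff_ne_zero.mpr (pow_pos P.L_pos _).ne'
  have hmem := woff_fine_mem c x μ
  obtain ⟨h1, h2⟩ := h μ
  rw [sitesPerDir_smallVol_zero]
  have h3 : P.L ^ P.K * 1 ≤ P.L ^ P.K * woff P P.K c (blk P P.K x) μ := Nat.mul_le_mul_left _ h1
  have h4 : P.L ^ P.K * (woff P P.K c (blk P P.K x) μ + 2) ≤ P.L ^ P.K * (smallVol P m').sitesPerDir P.K := Nat.mul_le_mul_left _ h2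
  constructor
  · omega
  · nlinarith

/-- `woff′(ι_K y) = woff(y)` on the window (chart of `T′₁^{(K)}` with corner `0`). [cite: Balaban1984PropagatorsII, p.238; bookkeeping] -/
theorem woff_iotaK {y : Site P P.K} (hy : InW P c m' y) (μ : Fin P.d) :
    woff (smallVol P m') P.K (origin (smallVol P m') P.K) (iotaK P c m' y) μ = woff P P.K c y μ := by
  unfold woff iotaK origin
  rw [sub_zero, ZMod.val_natCast, Nat.mod_eq_of_lt (hy μ)]
  rfl

/-- the block-aligned fine corner of the small torus at the unit corner `0` is `0`. [cite: Balaban1984PropagatorsII, (2.1) p.224; bookkeeping] -/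
theorem fine_origin (P : Params) (i : ℕ) : fine P i (origin P i) = origin P 0 := by
  funext μ
  unfold fine origin
  simp

/-- `woff′(ι₀ x) = woff(x)` on the fine window. [cite: Balaban1984PropagatorsII, p.238; bookkeeping] -/
theorem woff_iota0 {x : Site P 0} (hx : InW0 P c m' x) (μ : Fin P.d) :
    woff (smallVol P m') 0 (fine (smallVol P m') P.K (origin (smallVol P m') P.K)) (iota0 P c m' x) μ =
      woff P 0 (fine P P.K c) x μ := by
  rw [fine_origin]
  unfold woff iota0 origin
  rw [sub_zero, ZMod.val_natCast, Nat.mod_eq_of_lt (hx μ)]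
  rfl

/-- the label of `ι₀ x` is the chart coordinate of `x`. [cite: Balaban1984PropagatorsII, p.238; bookkeeping] -/
theorem val_iota0 {x : Site P 0} (hx : InW0 P c m' x) (μ : Fin P.d) : (iota0 P c m' x μ).val = woff P 0 (fine P P.K c) x μ := by
  unfold iota0; rw [ZMod.val_natCast, Nat.mod_eq_of_lt (hx μ)]

/-- the label of `ι_K y` is the chart coordinate of `y`. [cite: Balaban1984PropagatorsII, p.238; bookkeeping] -/
theorem val_iotaK {y : Site P P.K} (hy : InW P c m' y) (μ : Fin P.d) : (iotaK P c m' y μ).val = woff P P.K c y μ := by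
  unfold iotaK; rw [ZMod.val_natCast, Nat.mod_eq_of_lt (hy μ)]

/-- **blocks are transplanted to blocks**: `blk′(ι₀ x) = ι_K(blk x)` on the fine window. [cite: Balaban1984PropagatorsII, (2.1) p.224; bookkeeping] -/
theorem blk_iota0 {x : Site P 0} (hx : InW0 P c m' x) : blk (smallVol P m') P.K (iota0 P c m' x) = iotaK P c m' (blk P P.K x) := by
  have hK' : P.K ≤ (smallVol P m').m + (smallVol P m').K := Nat.le_add_left _ _
  have hW := (inW0_iff_inW x).mp hx
  funext μ
  apply ZMod.val_injective
  rw [blk_val (smallVol P m') hK', val_iota0 hx, val_iotaK hW, woff_fine_eq c x μ]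
  show (P.L ^ P.K * woff P P.K c (blk P P.K x) μ + (x μ).val % P.L ^ P.K) / P.L ^ P.K = woff P P.K c (blk P P.K x) μ
  have hn : 0 < P.L ^ P.K := pow_pos P.L_pos _
  rw [Nat.mul_add_div hn, Nat.div_eq_of_lt (Nat.mod_lt _ hn), add_zero]

/-- the chart coordinate of `κ₀ z` is the label of `z`. [cite: Balaban1984PropagatorsII, p.238; bookkeeping] -/
theorem woff_kap0 (hm : m' ≤ P.m) (z : Site (smallVol P m') 0) (μ : Fin P.d) :
    woff P 0 (fine P P.K c) (kap0 P c m' z) μ = (z μ).val := by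
  unfold woff kap0
  rw [add_sub_cancel_left, ZMod.val_natCast, Nat.mod_eq_of_lt]
  exact (ZMod.val_lt _).trans_le (sitesPerDir_smallVol_le P hm 0)

/-- `κ₀ z` is in the fine window. [cite: Balaban1984PropagatorsII, p.238; bookkeeping] -/
theorem inW0_kap0 (hm : m' ≤ P.m) (z : Site (smallVol P m') 0) : InW0 P c m' (kap0 P c m' z) :=
  fun μ => by rw [woff_kap0 hm]; exact ZMod.val_lt _

/-- `ι₀(κ₀ z) = z`. [cite: Balaban1984PropagatorsII, p.238; bookkeeping] -/
theorem iota0_kap0 (hm : m' ≤ P.m) (z : Site (smallVol P m') 0) : iota0 P c m' (kap0 P c m' z) = z := by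
  funext μ
  apply ZMod.val_injective
  rw [val_iota0 (inW0_kap0 hm z), woff_kap0 hm]

/-- `κ₀(ι₀ x) = x` on the fine window. [cite: Balaban1984PropagatorsII, p.238; bookkeeping] -/
theorem kap0_iota0 (hm : m' ≤ P.m) {x : Site P 0} (hx : InW0 P c m' x) : kap0 P c m' (iota0 P c m' x) = x :=
  eq_of_woff_eq 0 (fine P P.K c) fun μ => by rw [woff_kap0 hm, val_iota0 hx]

/-- `κ₀` is injective. [cite: Balaban1984PropagatorsII, p.238; bookkeeping] -/
theorem kap0_injective (hm : m' ≤ P.m) : Function.Injective (kap0 P c m') :=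
  fun z z' h => by rw [← iota0_kap0 (c := c) hm z, ← iota0_kap0 (c := c) hm z', h]

/-- `x = κ₀ z` iff `x` is in the window and `ι₀ x = z`. [cite: Balaban1984PropagatorsII, p.238; bookkeeping] -/
theorem eq_kap0_iff (hm : m' ≤ P.m) (x : Site P 0) (z : Site (smallVol P m') 0) :
    x = kap0 P c m' z ↔ InW0 P c m' x ∧ iota0 P c m' x = z := by
  constructor
  · rintro rfl; exact ⟨inW0_kap0 hm z, iota0_kap0 hm z⟩
  · rintro ⟨hx, rfl⟩; exact (kap0_iota0 hm hx).symm

/-- **the unit shift is transplanted to the unit shift** away from the window's upper seam. [cite: Balaban1984PropagatorsII, p.238; bookkeeping] -/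
theorem iota0_shift {x : Site P 0} (μ : Fin P.d) (h : woff P 0 (fine P P.K c) x μ + 1 < (smallVol P m').sitesPerDir 0)
    (hm : m' ≤ P.m) : iota0 P c m' (x.shift μ) = (iota0 P c m' x).shift μ := by
  have hlt : woff P 0 (fine P P.K c) x μ + 1 < P.sitesPerDir 0 := h.trans_le (sitesPerDir_smallVol_le P hm 0)
  funext ν
  by_cases hν : ν = μ
  · subst hν
    unfold iota0 Site.shift
    rw [Function.update_self]
    show ((woff P 0 (fine P P.K c) (Function.update x ν (x ν + 1)) ν : ℕ) : ZMod ((smallVol P m').sitesPerDir 0)) = _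
    have : Function.update x ν (x ν + 1) = x.shift ν := rfl
    rw [this, woff_shift_of_lt 0 _ x ν hlt]
    push_cast; ring
  · unfold iota0 Site.shift
    rw [Function.update_of_ne hν]
    show ((woff P 0 (fine P P.K c) (x.shift μ) ν : ℕ) : ZMod ((smallVol P m').sitesPerDir 0)) = _
    rw [woff_shift_ne 0 _ x hν]

/-- the backward unit shift is transplanted away from the lower seam. [cite: Balaban1984PropagatorsII, p.238; bookkeeping] -/
theorem iota0_unshift {x : Site P 0} (μ : Fin P.d) (h : 1 ≤ woff P 0 (fine P P.K c) x μ) :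
    iota0 P c m' (x.unshift μ) = (iota0 P c m' x).unshift μ := by
  funext ν
  by_cases hν : ν = μ
  · subst hν
    unfold iota0 Site.unshift
    rw [Function.update_self]
    show ((woff P 0 (fine P P.K c) (Function.update x ν (x ν - 1)) ν : ℕ) : ZMod ((smallVol P m').sitesPerDir 0)) = _
    have : Function.update x ν (x ν - 1) = x.unshift ν := rfl
    rw [this, woff_unshift_of_pos 0 _ x ν h, Nat.cast_sub h]
    push_cast; ring
  · unfold iota0 Site.unshift
    rw [Function.update_of_ne hν]
    show ((woff P 0 (fine P P.K c) (x.unshift μ) ν : ℕ) : ZMod ((smallVol P m').sitesPerDir 0)) = _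
    rw [woff_unshift_ne 0 _ x hν]

/-- block-mates stay in the window together. [cite: Balaban1984PropagatorsII, (2.1) p.224; bookkeeping] -/
theorem inW0_of_blk_eq {x x' : Site P 0} (hx : InW0 P c m' x) (h : blk P P.K x' = blk P P.K x) : InW0 P c m' x' := by
  rw [inW0_iff_inW] at hx ⊢; rwa [h]

/-- **the block of `x` is transplanted bijectively onto the block of `ι₀ x`**: block sums agree.
[cite: Balaban1984PropagatorsII, (2.1) p.224 (B^j(y)); bookkeeping] -/
theorem sum_block_transplant (hm : m' ≤ P.m) {x : Site P 0} (hx : InW0 P c m' x) (w : Site (smallVol P m') 0 → ℝ) :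
    ∑ x' ∈ univ.filter (fun x' => blk P P.K x' = blk P P.K x), w (iota0 P c m' x') =
      ∑ z' ∈ univ.filter (fun z' => blk (smallVol P m') P.K z' = blk (smallVol P m') P.K (iota0 P c m' x)), w z' := by
  refine Finset.sum_nbij (iota0 P c m') (fun x' hx' => ?_) (fun x₁ hx₁ x₂ hx₂ h => ?_) (fun z' hz' => ?_) (fun _ _ => rfl)
  · have hb := (Finset.mem_filter.mp hx').2
    refine Finset.mem_filter.mpr ⟨Finset.mem_univ _, ?_⟩
    rw [blk_iota0 (inW0_of_blk_eq hx hb), blk_iota0 hx, hb]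
  · have h1 := inW0_of_blk_eq hx (Finset.mem_filter.mp (Finset.mem_coe.mp hx₁)).2
    have h2 := inW0_of_blk_eq hx (Finset.mem_filter.mp (Finset.mem_coe.mp hx₂)).2
    rw [← kap0_iota0 hm h1, ← kap0_iota0 hm h2, h]
  · have hb := (Finset.mem_filter.mp (Finset.mem_coe.mp hz')).2
    refine ⟨kap0 P c m' z', Finset.mem_coe.mpr (Finset.mem_filter.mpr ⟨Finset.mem_univ _, ?_⟩), iota0_kap0 hm z'⟩
    -- blk (κ₀ z′) = blk x: both blocks are in the window and have the same transplant
    have hW := (inW0_iff_inW _).mp (inW0_kap0 (c := c) hm z')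
    have hWx := (inW0_iff_inW _).mp hx
    have key : iotaK P c m' (blk P P.K (kap0 P c m' z')) = iotaK P c m' (blk P P.K x) := by
      rw [← blk_iota0 (inW0_kap0 hm z'), iota0_kap0 hm, hb, blk_iota0 hx]
    refine eq_of_woff_eq P.K c fun μ => ?_
    rw [← val_iotaK hW, ← val_iotaK hWx, key]

/-- `ι_K` is injective on the unit window. [cite: Balaban1984PropagatorsII, p.238; bookkeeping] -/
theorem iotaK_injOn {y y' : Site P P.K} (hy : InW P c m' y) (hy' : InW P c m' y') (h : iotaK P c m' y = iotaK P c m' y') :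
    y = y' :=
  eq_of_woff_eq P.K c fun μ => by rw [← val_iotaK hy, ← val_iotaK hy', h]

/-- **the unit block `y` of the window is transplanted bijectively onto the block `ι_K y`**: block sums agree.
[cite: Balaban1984PropagatorsII, (2.1) p.224 (B^j(y)); bookkeeping] -/
theorem sum_block_transplant_unit (hm : m' ≤ P.m) {y : Site P P.K} (hy : InW P c m' y) (w : Site (smallVol P m') 0 → ℝ) :
    ∑ x' ∈ univ.filter (fun x' => blk P P.K x' = y), w (iota0 P c m' x') =
      ∑ z' ∈ univ.filter (fun z' => blk (smallVol P m') P.K z' = iotaK P c m' y), w z' := by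
  have hK : P.K ≤ P.m + P.K := Nat.le_add_left _ _
  have hb : blk P P.K (fine P P.K y) = y := B6Prop22OneScaleTorus.blk_fine P hK y
  have hx0 : InW0 P c m' (fine P P.K y) := (inW0_iff_inW _).mpr (by rw [hb]; exact hy)
  have h := sum_block_transplant hm hx0 w
  rw [blk_iota0 hx0, hb] at h
  exact h

end Maps

/-! ## §2  The pull-back matrix `J` -/

variable (P) in
/-- **the pull-back `J`** of functions on the small torus `T′_η = T_□̃` to functions on the big torus `T_η`: `(Jg)(x) = g(ι₀x)` on the
fine window `W₀`, `0` outside (`J x z = [x = κ₀ z]`). [cite: Balaban1984PropagatorsII, p.238 («identify it with a torus»)] -/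
def Jmat (c : Site P P.K) (m' : ℕ) : Matrix (Site P 0) (Site (smallVol P m') 0) ℝ :=
  fun x z => if x = kap0 P c m' z then 1 else 0

section Pullback

variable {c : Site P P.K} {m' : ℕ}

/-- `(Jg)(x) = g(ι₀ x)` on the fine window. [cite: Balaban1984PropagatorsII, p.238; bookkeeping] -/
theorem Jmat_mulVec_of_inW0 (hm : m' ≤ P.m) {x : Site P 0} (hx : InW0 P c m' x) (w : Site (smallVol P m') 0 → ℝ) :
    (Jmat P c m' *ᵥ w) x = w (iota0 P c m' x) := by
  simp only [Matrix.mulVec, dotProduct, Jmat]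
  have h : ∀ z, (x = kap0 P c m' z) ↔ (iota0 P c m' x = z) := fun z => by
    rw [eq_kap0_iff hm]; exact ⟨fun h => h.2, fun h => ⟨hx, h⟩⟩
  simp_rw [h]
  simp only [ite_mul, one_mul, zero_mul, Finset.sum_ite_eq, Finset.mem_univ, if_true]

/-- `(Jg)(x) = 0` off the fine window. [cite: Balaban1984PropagatorsII, p.238; bookkeeping] -/
theorem Jmat_mulVec_of_not_inW0 (hm : m' ≤ P.m) {x : Site P 0} (hx : ¬InW0 P c m' x) (w : Site (smallVol P m') 0 → ℝ) :
    (Jmat P c m' *ᵥ w) x = 0 := by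
  simp only [Matrix.mulVec, dotProduct, Jmat]
  refine Finset.sum_eq_zero fun z _ => ?_
  rw [if_neg, zero_mul]
  rintro rfl
  exact hx (inW0_kap0 hm z)

/-- `(Jᵀf)(z) = f(κ₀ z)` (restriction to the window, read in the chart). [cite: Balaban1984PropagatorsII, p.238; bookkeeping] -/
theorem Jmat_transpose_mulVec (f : Site P 0 → ℝ) (z : Site (smallVol P m') 0) :
    ((Jmat P c m')ᵀ *ᵥ f) z = f (kap0 P c m' z) := by
  simp only [Matrix.mulVec, dotProduct, Matrix.transpose_apply, Jmat, ite_mul, one_mul, zero_mul,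
    Finset.sum_ite_eq', Finset.mem_univ, if_true]

/-- `JᵀJ = 1` (the window parametrisation `κ₀` is injective). [cite: Balaban1984PropagatorsII, p.238; bookkeeping] -/
theorem Jmat_transpose_mul_Jmat (hm : m' ≤ P.m) : (Jmat P c m')ᵀ * Jmat P c m' = 1 := by
  ext z z'
  simp only [Matrix.mul_apply, Matrix.transpose_apply, Jmat, Matrix.one_apply, mul_ite, mul_one, mul_zero,
    Finset.sum_ite_eq', Finset.mem_univ, if_true]
  by_cases h : z = z'
  · subst h; simp
  · have h' : kap0 P c m' z' ≠ kap0 P c m' z := fun e => h ((kap0_injective hm) e).symm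
    rw [if_neg h', if_neg h]

end Pullback

/-! ## §3  Locality of `Δ′_a` under the transplant -/

section Locality

variable {c : Site P P.K} {m' : ℕ} {a msq : ℝ}

/-- the weight `L^{−Kd}` of the unit averaging is the same for the small volume. [cite: Balaban1984PropagatorsII, (2.1) p.224; bookkeeping] -/
theorem wQ_smallVol (m' : ℕ) : wQ (smallVol P m') (smallVol P m').K = wQ P P.K := by
  unfold wQ
  rw [lvl_of_le _ (Nat.le_add_left _ _), lvl_of_le _ (Nat.le_add_left _ _)]
  rfl

/-- the same, with the level written `P.K`. [cite: Balaban1984PropagatorsII, (2.1) p.224; bookkeeping] -/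
theorem wQ_smallVol' (m' : ℕ) : wQ (smallVol P m') P.K = wQ P P.K := wQ_smallVol (P := P) m'

/-- `Δ′_a` of the small torus, pointwise, in the letters of the big one (same `ε`, `a_K`, `L^{−Kd}`).
[cite: Balaban1984PropagatorsII, (2.13) p.225, p.238 («on this torus we define operators … as in (2.17), (2.19)»)] -/
theorem Dop_apply_smallVol (a msq : ℝ) (w : Site (smallVol P m') 0 → ℝ) (z : Site (smallVol P m') 0) :
    Dop (smallVol P m') a msq w z =
      msq * w z + deltaPrimeA (P.eps⁻¹) (blk (smallVol P m') P.K) (B1.aSeq a P.L P.K) (wQ P P.K) w z := by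
  rw [Dop_apply, wQ_smallVol]
  rfl

/-- the forward neighbour of a window site below the upper seam stays in the window. [cite: Balaban1984PropagatorsII, p.238; bookkeeping] -/
theorem inW0_shift (hm : m' ≤ P.m) {x : Site P 0} (hx : InW0 P c m' x) (μ : Fin P.d)
    (h : woff P 0 (fine P P.K c) x μ + 1 < (smallVol P m').sitesPerDir 0) : InW0 P c m' (x.shift μ) := by
  intro ν
  by_cases hν : ν = μ
  · subst hν
    rw [woff_shift_of_lt 0 _ x ν (h.trans_le (sitesPerDir_smallVol_le P hm 0))]
    exact h
  · rw [woff_shift_ne 0 _ x hν]; exact hx ν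

/-- the backward neighbour of a window site above the lower seam stays in the window. [cite: Balaban1984PropagatorsII, p.238; bookkeeping] -/
theorem inW0_unshift {x : Site P 0} (hx : InW0 P c m' x) (μ : Fin P.d) (h : 1 ≤ woff P 0 (fine P P.K c) x μ) :
    InW0 P c m' (x.unshift μ) := by
  intro ν
  by_cases hν : ν = μ
  · subst hν
    rw [woff_unshift_of_pos 0 _ x ν h]
    exact lt_of_le_of_lt (Nat.sub_le _ _) (hx ν)
  · rw [woff_unshift_ne 0 _ x hν]; exact hx ν

/-- **LOCALITY OF `Δ′_a` UNDER THE TRANSPLANT**: at a fine site of a deep block, `(Δ′_a(Jw))(x) = (Δ′_a^{T_□̃}w)(ι₀x)` — the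
operator *"defined on the torus T_□"* (p. 238) agrees with the big-torus operator away from the seam of the window (both are
`−Δ^η + m² + a_KQ′*Q′` with nearest-neighbour differences and block averages, and the transplant preserves neighbours and blocks there).
[cite: Balaban1984PropagatorsII, (2.13) p.225, p.238] -/
theorem deltaPrime_J_apply (hm : m' ≤ P.m) {x : Site P 0} (hx : DeepBlk P c m' (blk P P.K x))
    (w : Site (smallVol P m') 0 → ℝ) :
    (deltaPrimeK P a msq *ᵥ (Jmat P c m' *ᵥ w)) x = (deltaPrimeK (smallVol P m') a msq *ᵥ w) (iota0 P c m' x) := by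
  have hx0 : InW0 P c m' x := (inW0_iff_inW x).mpr (inW_of_deepBlk hx)
  rw [← Dop_apply_eq, ← Dop_apply_eq, Dop_apply, Dop_apply_smallVol, Jmat_mulVec_of_inW0 hm hx0]
  congr 1
  unfold deltaPrimeA
  congr 1
  · -- the Laplacian: neighbours are transplanted to neighbours
    unfold laplace
    refine Finset.sum_congr rfl fun μ _ => ?_
    obtain ⟨h1, h2⟩ := woff_bounds_of_deepBlk hx μ
    have h2' : woff P 0 (fine P P.K c) x μ + 1 < (smallVol P m').sitesPerDir 0 := by omega
    rw [Jmat_mulVec_of_inW0 hm hx0, Jmat_mulVec_of_inW0 hm (inW0_shift hm hx0 μ h2'),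
      Jmat_mulVec_of_inW0 hm (inW0_unshift hx0 μ h1), iota0_shift μ h2' hm, iota0_unshift μ h1]
  · -- the block average: the block is transplanted onto the block
    unfold blockAvgOp
    congr 1
    rw [← sum_block_transplant hm hx0 (fun z => wQ P P.K * w z)]
    refine Finset.sum_congr rfl fun x' hx' => ?_
    rw [Jmat_mulVec_of_inW0 hm (inW0_of_blk_eq hx0 (Finset.mem_filter.mp hx').2)]

/-- two matrices with the same action on vectors are equal. [folklore] -/
private theorem ext_of_mulVec {m n : Type*} [Fintype n] [DecidableEq n] {M N : Matrix m n ℝ}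
    (h : ∀ v, M *ᵥ v = N *ᵥ v) : M = N :=
  Matrix.toLin'.injective (LinearMap.ext fun v => by rw [Matrix.toLin'_apply, Matrix.toLin'_apply, h v])

/-- **locality as a matrix identity**: `diag(s)·Δ′_a·J = diag(s)·J·Δ′_a^{T_□̃}` for `s` supported on deep blocks.
[cite: Balaban1984PropagatorsII, (2.13) p.225, p.238] -/
theorem diag_mul_deltaPrime_mul_J (hm : m' ≤ P.m) {s : Site P 0 → ℝ} (hs : ∀ x, s x ≠ 0 → DeepBlk P c m' (blk P P.K x)) :
    Matrix.diagonal s * deltaPrimeK P a msq * Jmat P c m' =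
      Matrix.diagonal s * Jmat P c m' * deltaPrimeK (smallVol P m') a msq := by
  refine ext_of_mulVec fun w => funext fun x => ?_
  rw [← Matrix.mulVec_mulVec, ← Matrix.mulVec_mulVec, Matrix.mulVec_diagonal, ← Matrix.mulVec_mulVec,
    ← Matrix.mulVec_mulVec, Matrix.mulVec_diagonal]
  by_cases h0 : s x = 0
  · rw [h0, zero_mul, zero_mul]
  · have hx := hs x h0
    rw [deltaPrime_J_apply hm hx, Jmat_mulVec_of_inW0 hm ((inW0_iff_inW x).mpr (inW_of_deepBlk hx))]

/-- the transposed identity `Jᵀ·Δ′_a·diag(s) = Δ′_a^{T_□̃}·Jᵀ·diag(s)` (both `Δ′_a` symmetric). [cite: Balaban1984PropagatorsII, (2.13) p.225, p.238] -/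
theorem Jt_mul_deltaPrime_mul_diag (hm : m' ≤ P.m) {s : Site P 0 → ℝ} (hs : ∀ x, s x ≠ 0 → DeepBlk P c m' (blk P P.K x)) :
    (Jmat P c m')ᵀ * deltaPrimeK P a msq * Matrix.diagonal s =
      deltaPrimeK (smallVol P m') a msq * (Jmat P c m')ᵀ * Matrix.diagonal s := by
  have h := congrArg Matrix.transpose (diag_mul_deltaPrime_mul_J (a := a) (msq := msq) hm hs)
  rw [Matrix.transpose_mul, Matrix.transpose_mul, Matrix.transpose_mul, Matrix.transpose_mul,
    Matrix.diagonal_transpose, deltaPrimeK_transpose, deltaPrimeK_transpose] at h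
  rw [Matrix.mul_assoc, Matrix.mul_assoc]
  exact h

/-- `Δ′_a` reads a function only on the block of `x` and the nearest neighbours of `x`. [cite: Balaban1984PropagatorsII, (2.13) p.225; bookkeeping] -/
theorem Dop_apply_congr (a msq : ℝ) {f f' : Site P 0 → ℝ} {x : Site P 0}
    (hb : ∀ x', blk P P.K x' = blk P P.K x → f x' = f' x')
    (hn : ∀ μ, f (x.shift μ) = f' (x.shift μ) ∧ f (x.unshift μ) = f' (x.unshift μ)) :
    Dop P a msq f x = Dop P a msq f' x := by
  rw [Dop_apply, Dop_apply, hb x rfl]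
  congr 1
  unfold deltaPrimeA
  congr 1
  · unfold laplace
    refine Finset.sum_congr rfl fun μ _ => ?_
    rw [(hn μ).1, (hn μ).2, hb x rfl]
  · unfold blockAvgOp
    congr 1
    exact Finset.sum_congr rfl fun x' hx' => by rw [hb x' (Finset.mem_filter.mp hx').2]

end Locality

/-! ## §4  The local inverse `G′(□̃) = 1_V·J·G′_{T_□̃}·Jᵀ·1_V` and its cut algebra -/

section LocalInverse

variable {c : Site P P.K} {m' : ℕ} {a msq : ℝ}

variable (P) in
/-- the indicator of the fine sites whose unit block lies in `V`. [cite: Balaban1984PropagatorsII, p.238; bookkeeping] -/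
def indV (V : Finset (Site P P.K)) (x : Site P 0) : ℝ := if blk P P.K x ∈ V then 1 else 0

variable (P) in
/-- **`G′(□̃)` cut to the core `V`**: the matrix `1_V·J·G′_{T_□̃}·Jᵀ·1_V` on `L²(T_η)` — the Green's function `Δ′_a⁻¹` of the small
torus `T_□̃` (`(B1RG242Torus.tower P′ a m²).G K`, Prop. 2.2's operator of the volume `P′`), pulled back to the window and restricted
on both sides to the fine sites over the unit blocks `V`. [cite: Balaban1984PropagatorsII, p.235 («an inverse of the operator
(Q′G′(□̃)²Q′*)↾□»), p.238 («identify it with a torus»)] -/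
def GwMat (c : Site P P.K) (m' : ℕ) (V : Finset (Site P P.K)) (a msq : ℝ) : Matrix (Site P 0) (Site P 0) ℝ :=
  Matrix.diagonal (indV P V) * Jmat P c m' * (tower (smallVol P m') a msq).G (smallVol P m').K * (Jmat P c m')ᵀ *
    Matrix.diagonal (indV P V)

variable (P) in
/-- `G′(□̃)` (cut to `V`) as an endomorphism of `L²(T_η)`. [cite: Balaban1984PropagatorsII, p.235, p.238] -/
def Gw (c : Site P P.K) (m' : ℕ) (V : Finset (Site P P.K)) (a msq : ℝ) : Module.End ℝ (Site P 0 → ℝ) :=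
  Matrix.toLin' (GwMat P c m' V a msq)

variable {V : Finset (Site P P.K)}

/-- `G′(□̃)f = GwMat *ᵥ f`. [cite: Balaban1984PropagatorsII, p.238; bookkeeping] -/
theorem Gw_apply_eq (f : Site P 0 → ℝ) : Gw P c m' V a msq f = GwMat P c m' V a msq *ᵥ f := Matrix.toLin'_apply _ _

/-- `indV` vanishes off `V`-blocks and is `1` on them. [cite: Balaban1984PropagatorsII, p.238; bookkeeping] -/
theorem indV_of_mem {x : Site P 0} (h : blk P P.K x ∈ V) : indV P V x = 1 := if_pos h

/-- `indV` vanishes off `V`-blocks. [cite: Balaban1984PropagatorsII, p.238; bookkeeping] -/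
theorem indV_of_not_mem {x : Site P 0} (h : blk P P.K x ∉ V) : indV P V x = 0 := if_neg h

/-- `G′(□̃)` (cut) is symmetric. [cite: Balaban1984PropagatorsII, (2.17) p.225, p.238; bookkeeping] -/
theorem GwMat_transpose (ha : 0 < a) (hm0 : 0 ≤ msq) (hK : 1 ≤ P.K) : (GwMat P c m' V a msq)ᵀ = GwMat P c m' V a msq := by
  unfold GwMat
  simp only [Matrix.transpose_mul, Matrix.diagonal_transpose, Matrix.transpose_transpose,
    G_transpose (smallVol P m') ha hm0 hK, Matrix.mul_assoc]

/-- **the pointwise form of `G′(□̃)`**: `(G′(□̃)f)(x) = 1_V(x)·(G′_{T_□̃}(Jᵀ(1_Vf)))(ι₀x)`.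
[cite: Balaban1984PropagatorsII, p.238; bookkeeping] -/
theorem GwMat_mulVec (hm : m' ≤ P.m) (hV : ∀ y ∈ V, DeepBlk P c m' y) (f : Site P 0 → ℝ) (x : Site P 0) :
    (GwMat P c m' V a msq *ᵥ f) x = indV P V x *
      ((tower (smallVol P m') a msq).G (smallVol P m').K *ᵥ
        ((Jmat P c m')ᵀ *ᵥ (Matrix.diagonal (indV P V) *ᵥ f))) (iota0 P c m' x) := by
  unfold GwMat
  rw [← Matrix.mulVec_mulVec, ← Matrix.mulVec_mulVec, ← Matrix.mulVec_mulVec, ← Matrix.mulVec_mulVec,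
    Matrix.mulVec_diagonal]
  by_cases hx : blk P P.K x ∈ V
  · rw [Jmat_mulVec_of_inW0 hm ((inW0_iff_inW x).mpr (inW_of_deepBlk (hV _ hx)))]
  · rw [indV_of_not_mem hx, zero_mul, zero_mul]

/-- `(Jᵀ(1_Vf))(z) = 1_V(κ₀z)f(κ₀z)`. [cite: Balaban1984PropagatorsII, p.238; bookkeeping] -/
theorem Jt_indV_mulVec (f : Site P 0 → ℝ) (z : Site (smallVol P m') 0) :
    ((Jmat P c m')ᵀ *ᵥ (Matrix.diagonal (indV P V) *ᵥ f)) z = indV P V (kap0 P c m' z) * f (kap0 P c m' z) := by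
  rw [Jmat_transpose_mulVec, Matrix.mulVec_diagonal]

/-- support absorption: `diag(χ)·Δ′_a·1_V = diag(χ)·Δ′_a` when the `Δ′_a`-range of `supp χ` lies over `V`.
[cite: Balaban1984PropagatorsII, (2.13) p.225; bookkeeping] -/
theorem diag_chi_mul_D_mul_indV {χ : Site P 0 → ℝ}
    (hχV : ∀ x, χ x ≠ 0 → blk P P.K x ∈ V ∧ ∀ μ, blk P P.K (x.shift μ) ∈ V ∧ blk P P.K (x.unshift μ) ∈ V) :
    Matrix.diagonal χ * deltaPrimeK P a msq * Matrix.diagonal (indV P V) = Matrix.diagonal χ * deltaPrimeK P a msq := by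
  refine ext_of_mulVec fun f => funext fun x => ?_
  rw [← Matrix.mulVec_mulVec, ← Matrix.mulVec_mulVec, Matrix.mulVec_diagonal, ← Matrix.mulVec_mulVec,
    Matrix.mulVec_diagonal]
  by_cases h0 : χ x = 0
  · rw [h0, zero_mul, zero_mul]
  · obtain ⟨hxV, hnb⟩ := hχV x h0
    congr 1
    rw [← Dop_apply_eq, ← Dop_apply_eq]
    refine Dop_apply_congr a msq (fun x' hx' => ?_) (fun μ => ⟨?_, ?_⟩)
    · rw [Matrix.mulVec_diagonal, indV_of_mem (hx' ▸ hxV), one_mul]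
    · rw [Matrix.mulVec_diagonal, indV_of_mem (hnb μ).1, one_mul]
    · rw [Matrix.mulVec_diagonal, indV_of_mem (hnb μ).2, one_mul]

/-- `diag(χ)·J·Jᵀ·1_V = diag(χ)` when `supp χ` lies over `V ⊂ W`. [cite: Balaban1984PropagatorsII, p.238; bookkeeping] -/
theorem diag_chi_mul_J_mul_Jt_mul_indV (hm : m' ≤ P.m) (hV : ∀ y ∈ V, DeepBlk P c m' y) {χ : Site P 0 → ℝ}
    (hχV : ∀ x, χ x ≠ 0 → blk P P.K x ∈ V) :
    Matrix.diagonal χ * Jmat P c m' * (Jmat P c m')ᵀ * Matrix.diagonal (indV P V) = Matrix.diagonal χ := by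
  refine ext_of_mulVec fun f => funext fun x => ?_
  rw [← Matrix.mulVec_mulVec, ← Matrix.mulVec_mulVec, ← Matrix.mulVec_mulVec, Matrix.mulVec_diagonal,
    Matrix.mulVec_diagonal]
  by_cases h0 : χ x = 0
  · rw [h0, zero_mul, zero_mul]
  · have hxV := hχV x h0
    have hx0 : InW0 P c m' x := (inW0_iff_inW x).mpr (inW_of_deepBlk (hV _ hxV))
    rw [Jmat_mulVec_of_inW0 hm hx0, Jt_indV_mulVec, kap0_iota0 hm hx0, indV_of_mem hxV, one_mul]

/-- **THE CUT ALGEBRA, left**: `diag(χ)·Δ′_a·G′(□̃) = diag(χ)` — on the support of the cut-off, `G′(□̃)` inverts `Δ′_a` (locality of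
`Δ′_a` under the transplant + `Δ′_a^{T_□̃}G′_{T_□̃} = 1` on the small torus). Hypotheses: `V` deep blocks of the window; the support of
`χ` together with its nearest neighbours lies over `V`. [cite: Balaban1984PropagatorsII, (2.17) p.225, p.235, p.238] -/
theorem diag_chi_mul_D_mul_Gw (ha : 0 < a) (hm0 : 0 ≤ msq) (hK : 1 ≤ P.K) (hm : m' ≤ P.m)
    (hV : ∀ y ∈ V, DeepBlk P c m' y) {χ : Site P 0 → ℝ}
    (hχV : ∀ x, χ x ≠ 0 → blk P P.K x ∈ V ∧ ∀ μ, blk P P.K (x.shift μ) ∈ V ∧ blk P P.K (x.unshift μ) ∈ V) :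
    Matrix.diagonal χ * deltaPrimeK P a msq * GwMat P c m' V a msq = Matrix.diagonal χ := by
  have hA := diag_chi_mul_D_mul_indV (a := a) (msq := msq) hχV
  have hB := diag_mul_deltaPrime_mul_J (a := a) (msq := msq) hm (s := χ) fun x hx => hV _ (hχV x hx).1
  have hC : deltaPrimeK (smallVol P m') a msq * (tower (smallVol P m') a msq).G (smallVol P m').K = 1 :=
    deltaPrimeK_mul_G (smallVol P m') ha hm0 hK
  have hD := diag_chi_mul_J_mul_Jt_mul_indV hm hV (χ := χ) fun x hx => (hχV x hx).1
  unfold GwMat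
  calc Matrix.diagonal χ * deltaPrimeK P a msq * (Matrix.diagonal (indV P V) * Jmat P c m' *
        (tower (smallVol P m') a msq).G (smallVol P m').K * (Jmat P c m')ᵀ * Matrix.diagonal (indV P V))
      = Matrix.diagonal χ * deltaPrimeK P a msq * Matrix.diagonal (indV P V) * Jmat P c m' *
        (tower (smallVol P m') a msq).G (smallVol P m').K * (Jmat P c m')ᵀ * Matrix.diagonal (indV P V) := by
        simp only [Matrix.mul_assoc]
    _ = Matrix.diagonal χ * Jmat P c m' *
        (deltaPrimeK (smallVol P m') a msq * (tower (smallVol P m') a msq).G (smallVol P m').K) * (Jmat P c m')ᵀ *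
        Matrix.diagonal (indV P V) := by
        rw [hA, hB]; simp only [Matrix.mul_assoc]
    _ = Matrix.diagonal χ := by rw [hC, Matrix.mul_one, hD]

/-- **THE CUT ALGEBRA, right**: `G′(□̃)·Δ′_a·diag(χ) = diag(χ)` (transpose of the left identity; `Δ′_a`, `G′(□̃)` symmetric).
[cite: Balaban1984PropagatorsII, (2.17) p.225, p.235, p.238] -/
theorem Gw_mul_D_mul_diag_chi (ha : 0 < a) (hm0 : 0 ≤ msq) (hK : 1 ≤ P.K) (hm : m' ≤ P.m)
    (hV : ∀ y ∈ V, DeepBlk P c m' y) {χ : Site P 0 → ℝ}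
    (hχV : ∀ x, χ x ≠ 0 → blk P P.K x ∈ V ∧ ∀ μ, blk P P.K (x.shift μ) ∈ V ∧ blk P P.K (x.unshift μ) ∈ V) :
    GwMat P c m' V a msq * deltaPrimeK P a msq * Matrix.diagonal χ = Matrix.diagonal χ := by
  have h := congrArg Matrix.transpose (diag_chi_mul_D_mul_Gw ha hm0 hK hm hV hχV)
  rw [Matrix.transpose_mul, Matrix.transpose_mul, Matrix.diagonal_transpose, deltaPrimeK_transpose,
    GwMat_transpose ha hm0 hK] at h
  rw [Matrix.mul_assoc]
  exact h

/-- a diagonal matrix acts as the multiplication operator. [folklore] -/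
private theorem toLin'_diagonal_eq_mulOp (h : Site P 0 → ℝ) :
    Matrix.toLin' (Matrix.diagonal h) = (mulOp h : Module.End ℝ (Site P 0 → ℝ)) := by
  refine LinearMap.ext fun f => ?_
  rw [Matrix.toLin'_apply]
  funext x
  rw [Matrix.mulVec_diagonal, mulOp_apply]

/-- **`hχGw` of the line-3 chain** (`B6Prop23DomainInput.hdom_of_line3`, `B6DomainMajorant.cutHyp_left`) for the GENUINE operators:
`χ·Δ′_a·G′(□̃) = χ` as endomorphisms of `L²(T_η)`. [cite: Balaban1984PropagatorsII, (2.17) p.225, p.235, p.238] -/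
theorem cutHyp_left_Gw (ha : 0 < a) (hm0 : 0 ≤ msq) (hK : 1 ≤ P.K) (hm : m' ≤ P.m)
    (hV : ∀ y ∈ V, DeepBlk P c m' y) {χ : Site P 0 → ℝ}
    (hχV : ∀ x, χ x ≠ 0 → blk P P.K x ∈ V ∧ ∀ μ, blk P P.K (x.shift μ) ∈ V ∧ blk P P.K (x.unshift μ) ∈ V) :
    mulOp χ * Dop P a msq * Gw P c m' V a msq = mulOp χ := by
  rw [← toLin'_diagonal_eq_mulOp, Dop, Gw, Module.End.mul_eq_comp, Module.End.mul_eq_comp, ← Matrix.toLin'_mul,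
    ← Matrix.toLin'_mul, diag_chi_mul_D_mul_Gw ha hm0 hK hm hV hχV]

/-- **`hGwχ` of the line-3 chain**: `G′(□̃)·Δ′_a·χ = χ`. [cite: Balaban1984PropagatorsII, (2.17) p.225, p.235, p.238] -/
theorem cutHyp_right_Gw (ha : 0 < a) (hm0 : 0 ≤ msq) (hK : 1 ≤ P.K) (hm : m' ≤ P.m)
    (hV : ∀ y ∈ V, DeepBlk P c m' y) {χ : Site P 0 → ℝ}
    (hχV : ∀ x, χ x ≠ 0 → blk P P.K x ∈ V ∧ ∀ μ, blk P P.K (x.shift μ) ∈ V ∧ blk P P.K (x.unshift μ) ∈ V) :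
    Gw P c m' V a msq * Dop P a msq * mulOp χ = mulOp χ := by
  rw [← toLin'_diagonal_eq_mulOp, Dop, Gw, Module.End.mul_eq_comp, Module.End.mul_eq_comp, ← Matrix.toLin'_mul,
    ← Matrix.toLin'_mul, Gw_mul_D_mul_diag_chi ha hm0 hK hm hV hχV]

end LocalInverse

end

end Literature.MathematicalPhysics.QuantumFieldTheory.Balaban1983to89.B6TorusTransplant
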